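import Summits.PneNP.PneNP.Theorems.PhaseTwinsPolyDepthTwinsAboveConnectorIndep

/-!
# Route PhaseTwins, crux `PolyDepthTwinsAbove` (stmt-PneNP-2719), line `parity-wired-ports`:
# `stub_connector`, part 2 — `Z_{pwGraph c}(λ; phases Y)` grouped by port configurations

The decompositions of Sly's Lemma 2.2 for the parity wiring. First the split of a configuration into
its copy part and its complex part (`sum_finset_disjSum`, `copyFib_disjSum`, `pwPhase_disjSum`), the
grouping of copy configurations by fibres (`prod_hardcoreZOn_eq_sum_fib`) and
`Z_{base}(λ; phases Y) = (1+λ)^{10 M κ₂} Π_g Z_G(λ; Y_g)` (`hardcoreZOn_pwBase_phase`); then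
`Z_{pwGraph c}(λ; phases Y) = Σ_P pwPatFactor P · Π_g Z_G(λ; Y_g, σ_V = P g)` (`hardcoreZOn_pwGraph_phase_eq_sum`),
the sum running over the families `P` of port configurations of the `6M` copies (the shape of the tree's
`hardcoreZOn_gadgetSubst_phaseVec_eq_sum` for Sly's `H^G`). Ingredients: the split of a configuration
into copy part and complex part (part 1), the independence criterion `isIndepSet_pwGraph_iff`, the
factorisation of the complex parts `sum_cxPart_eq_prod`, and the grouping of copy configurations by their
port configurations (`prod_hardcoreZOn_eq_sum_fib`). [cite: Sly2010, Lemma 2.2 (proof)]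
-/

noncomputable section

open scoped Classical BigOperators

namespace Summit.PneNP.PneNP.Cruxes.PolyDepthTwinsAbove.ParityWiredPorts

open Finset
open Literature.Computability.Complexity (hardcoreZOn hardcoreZOn_def slyPhase portPattern
  mem_portPattern_fst mem_portPattern_snd SlyReduction.isIndepSet_coe_finset_iff)
open Literature.Computability.Complexity.Expander (RotGraph)
open Literature.ModelTheory.FiniteModelTheory.TseitinColouring (Dart)
open Literature.ModelTheory.FiniteModelTheory.CFIMatching (bit Canon)
open Literature.Probability.LatticeModels (independencePolynomial)

set_option linter.dupNamespace false

variable {M v m κ₁ κ₂ : ℕ}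

/-! ## Splitting configurations into copy part and complex part -/

/-- Sums over configurations of a sum type are double sums over the two traces. -/
theorem sum_finset_disjSum {A B : Type*} [Fintype A] [Fintype B] [DecidableEq A] [DecidableEq B]
    (F : Finset (A ⊕ B) → ℝ) :
    ∑ I : Finset (A ⊕ B), F I = ∑ I₁ : Finset A, ∑ I₂ : Finset B, F (I₁.disjSum I₂) := by
  rw [← Fintype.sum_prod_type']
  refine Fintype.sum_equiv Finset.sumEquiv.toEquiv _ _ fun I => ?_
  simp only [RelIso.coe_fn_toEquiv, Finset.sumEquiv_apply_fst, Finset.sumEquiv_apply_snd,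
    toLeft_disjSum_toRight]

/-- The copy fibres of a split configuration only see the copy part. -/
theorem copyFib_disjSum (I₁ : Finset (Dart M 3 × ZMod 2 × Fin v))
    (I₂ : Finset ((Fin M × Fin 3 × ZMod 2 × Fin κ₂) ⊕ (Fin M × (Fin 2 → ZMod 2) × Fin κ₂)))
    (g : Dart M 3 × ZMod 2) :
    copyFib (I₁.disjSum I₂) g = univ.filter fun x => (g.1, g.2, x) ∈ I₁ := by
  ext x
  simp [copyFib, Finset.inl_mem_disjSum]

/-- The phase vector of a split configuration only sees the copy part. -/
theorem pwPhase_disjSum (W : Wiring v m κ₁ κ₂) (I₁ : Finset (Dart M 3 × ZMod 2 × Fin v))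
    (I₂ : Finset ((Fin M × Fin 3 × ZMod 2 × Fin κ₂) ⊕ (Fin M × (Fin 2 → ZMod 2) × Fin κ₂))) :
    pwPhase W (I₁.disjSum I₂) = fun g => slyPhase W.Wp W.Wm (univ.filter fun x => (g.1, g.2, x) ∈ I₁) := by
  funext g
  rw [pwPhase, copyFib_disjSum]

/-- **Products of restricted partition functions of the gadget over the copies** are sums over the
configurations of `(copy) × (gadget vertex)` whose fibres are independent and satisfy the events
(the tree's `prod_hardcoreZOn_eq_sum`, for an arbitrary finite index type). -/
theorem prod_hardcoreZOn_eq_sum_fib (G : SimpleGraph (Fin v)) (lam : ℝ)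
    (E : (Dart M 3 × ZMod 2) → Finset (Fin v) → Prop) [∀ g, DecidablePred (E g)] :
    ∏ g : Dart M 3 × ZMod 2, hardcoreZOn G lam (E g) =
      ∑ J : Finset ((Dart M 3 × ZMod 2) × Fin v),
        if ∀ g, G.IsIndepSet (↑(univ.filter fun x => (g, x) ∈ J) : Set (Fin v)) ∧
            E g (univ.filter fun x => (g, x) ∈ J)
        then lam ^ J.card else 0 := by
  simp only [hardcoreZOn_def]
  rw [Fintype.prod_sum]
  symm
  refine Fintype.sum_equiv ⟨fun t k => univ.filter fun l => (k, l) ∈ t,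
    fun S => univ.filter fun x => x.2 ∈ S x.1, fun t => ?_, fun S => ?_⟩ _ _ fun J => ?_
  · ext x
    simp
  · funext k
    ext l
    simp
  · simp only [Equiv.coe_fn_mk]
    by_cases h : ∀ g, G.IsIndepSet (↑(univ.filter fun x => (g, x) ∈ J) : Set (Fin v)) ∧
        E g (univ.filter fun x => (g, x) ∈ J)
    · rw [if_pos h, card_eq_sum_card_fib J, ← prod_pow_eq_pow_sum]
      refine prod_congr rfl fun g _ => ?_
      split_ifs with hg
      · rfl
      · exact absurd (h g) hg
    · rw [if_neg h]
      obtain ⟨g, hg⟩ := not_forall.1 h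
      symm
      refine prod_eq_zero (mem_univ g) ?_
      simp only [hg, if_false]

/-- `Σ_{I₂} λ^{|I₂|} = (1 + λ)^{#vertices}` (binomial theorem). -/
theorem sum_pow_card_eq {X : Type*} [Fintype X] [DecidableEq X] (lam : ℝ) :
    ∑ t : Finset X, lam ^ t.card = (1 + lam) ^ Fintype.card X := by
  have h := Finset.sum_pow_mul_eq_add_pow lam 1 (univ : Finset X)
  simp only [one_pow, mul_one, Finset.powerset_univ, Finset.card_univ] at h
  rw [h, add_comm]

/-- Membership in a re-bracketed copy configuration. -/
theorem mem_map_prodAssoc_symm (I₁ : Finset (Dart M 3 × ZMod 2 × Fin v)) (g : Dart M 3 × ZMod 2) (x : Fin v) :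
    (g, x) ∈ I₁.map (Equiv.prodAssoc (Dart M 3) (ZMod 2) (Fin v)).symm.toEmbedding ↔ (g.1, g.2, x) ∈ I₁ := by
  rw [mem_map_equiv, Equiv.symm_symm, Equiv.prodAssoc_apply]

/-- **`Z_{base}(λ; phases Y) = (1+λ)^{10 M κ₂} · Π_g Z_G(λ; Y = Y_g)`**: on `pwBase` the copies are
independent and the `10 M κ₂` complex vertices are isolated. -/
theorem hardcoreZOn_pwBase_phase (W : Wiring v m κ₁ κ₂) (lam : ℝ) (Y : Dart M 3 × ZMod 2 → Bool) :
    hardcoreZOn (pwBase M κ₂ W) lam (fun I => pwPhase W I = Y) =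
      (1 + lam) ^ Fintype.card ((Fin M × Fin 3 × ZMod 2 × Fin κ₂) ⊕ (Fin M × (Fin 2 → ZMod 2) × Fin κ₂)) *
        ∏ g : Dart M 3 × ZMod 2, hardcoreZOn W.G lam (fun S => slyPhase W.Wp W.Wm S = Y g) := by
  rw [hardcoreZOn_def, sum_finset_disjSum, prod_hardcoreZOn_eq_sum_fib, Finset.mul_sum]
  refine Fintype.sum_equiv (Equiv.finsetCongr (Equiv.prodAssoc (Dart M 3) (ZMod 2) (Fin v)).symm) _ _
    fun I₁ => ?_
  rw [Equiv.finsetCongr_apply, card_map, ← sum_pow_card_eq lam, sum_mul]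
  refine sum_congr rfl fun I₂ _ => ?_
  have hiff : ((pwBase M κ₂ W).IsIndepSet (↑(I₁.disjSum I₂) : Set (PWVert M v κ₂)) ∧
      pwPhase W (I₁.disjSum I₂) = Y) ↔
      ∀ g : Dart M 3 × ZMod 2, W.G.IsIndepSet
          (↑(univ.filter fun x => (g, x) ∈
            I₁.map (Equiv.prodAssoc (Dart M 3) (ZMod 2) (Fin v)).symm.toEmbedding) : Set (Fin v)) ∧
        slyPhase W.Wp W.Wm (univ.filter fun x => (g, x) ∈
            I₁.map (Equiv.prodAssoc (Dart M 3) (ZMod 2) (Fin v)).symm.toEmbedding) = Y g := by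
    rw [isIndepSet_pwBase_iff, pwPhase_disjSum, funext_iff, ← forall_and]
    refine forall_congr' fun g => ?_
    simp only [copyFib_disjSum, mem_map_prodAssoc_symm]
  split_ifs with h₁ h₂ h₂
  · rw [card_disjSum, pow_add, mul_comm]
  · exact absurd (hiff.1 h₁) h₂
  · exact absurd (hiff.2 h₂) h₁
  · rw [mul_zero]

/-- Port membership in the pattern family of a copy configuration (`V⁺` side). -/
theorem mem_patFam_fst (W : Wiring v m κ₁ κ₂) (J : Finset ((Dart M 3 × ZMod 2) × Fin v))
    (g : Dart M 3 × ZMod 2) (i : Fin m) :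
    i ∈ (portPattern W.Vp W.Vm (univ.filter fun x => (g, x) ∈ J)).1 ↔ (g, W.Vp i) ∈ J := by
  rw [mem_portPattern_fst, mem_filter]
  simp

/-- Port membership in the pattern family of a copy configuration (`V⁻` side). -/
theorem mem_patFam_snd (W : Wiring v m κ₁ κ₂) (J : Finset ((Dart M 3 × ZMod 2) × Fin v))
    (g : Dart M 3 × ZMod 2) (i : Fin m) :
    i ∈ (portPattern W.Vp W.Vm (univ.filter fun x => (g, x) ∈ J)).2 ↔ (g, W.Vm i) ∈ J := by
  rw [mem_portPattern_snd, mem_filter]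
  simp

/-- **The pattern factor of a copy configuration**: for the family of port configurations of a copy
configuration `I₁` (re-bracketed as `J`), `pwPatFactor` is the pair indicator of `I₁` times the product of
the local factors at the vacancy indicators of the ports the ends plug into. -/
theorem pwPatFactor_patFam (R : RotGraph M 3) (W : Wiring v m κ₁ κ₂) (lam : ℝ) (c : Fin M → ZMod 2)
    (I₁ : Finset (Dart M 3 × ZMod 2 × Fin v)) :
    pwPatFactor R W lam c (fun g => portPattern W.Vp W.Vm (univ.filter fun x => (g, x) ∈
        I₁.map (Equiv.prodAssoc (Dart M 3) (ZMod 2) (Fin v)).symm.toEmbedding)) =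
      (if ∀ δ : Dart M 3, Canon R δ → ∀ j : Fin κ₁,
          ¬ ((δ, (0 : ZMod 2), W.Vp (W.slot (Sum.inl j))) ∈ I₁ ∧ (δ, (1 : ZMod 2), W.Vp (W.slot (Sum.inl j))) ∈ I₁) ∧
            ¬ ((δ, (0 : ZMod 2), W.Vm (W.slot (Sum.inl j))) ∈ I₁ ∧ (δ, (1 : ZMod 2), W.Vm (W.slot (Sum.inl j))) ∈ I₁)
        then (1 : ℝ) else 0) *
      ∏ k : Fin M × Fin κ₂, cxWeight (c k.1) lam fun l =>
        if endPort R W (k.1, l.1, l.2, k.2) ∈ I₁ then 0 else 1 := by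
  unfold pwPatFactor
  have hmem : ∀ (g : Dart M 3 × ZMod 2) (x : Fin v), (g, x) ∈
      I₁.map (Equiv.prodAssoc (Dart M 3) (ZMod 2) (Fin v)).symm.toEmbedding ↔ (g.1, g.2, x) ∈ I₁ :=
    mem_map_prodAssoc_symm I₁
  congr 1
  · simp only [mem_portPattern_fst, mem_portPattern_snd, mem_filter, mem_univ, true_and, hmem]
  · refine prod_congr rfl fun k _ => ?_
    congr 1
    funext l
    simp only [mem_portPattern_fst, mem_filter, mem_univ, true_and, hmem, endPort]
    split_ifs <;> rfl

/-- The copy fibres of a configuration and of its re-bracketing agree. -/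
theorem filter_map_prodAssoc_symm (I₁ : Finset (Dart M 3 × ZMod 2 × Fin v)) (g : Dart M 3 × ZMod 2) :
    (univ.filter fun x => (g, x) ∈ I₁.map (Equiv.prodAssoc (Dart M 3) (ZMod 2) (Fin v)).symm.toEmbedding) =
      univ.filter fun x => (g.1, g.2, x) ∈ I₁ := by
  ext x
  simp only [mem_filter, mem_univ, true_and, mem_map_prodAssoc_symm]

/-- **The independence-and-phase event of a split configuration**, in terms of the copy part `I₁` and the
complex part `I₂` (unfolding `isIndepSet_pwGraph_iff` and `pwPhase` on `I₁ ⊔ I₂`). -/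
theorem indep_phase_disjSum_iff (R : RotGraph M 3) (W : Wiring v m κ₁ κ₂) (c : Fin M → ZMod 2)
    (Y : Dart M 3 × ZMod 2 → Bool) (I₁ : Finset (Dart M 3 × ZMod 2 × Fin v))
    (I₂ : Finset ((Fin M × Fin 3 × ZMod 2 × Fin κ₂) ⊕ (Fin M × (Fin 2 → ZMod 2) × Fin κ₂))) :
    ((pwGraph R W c).IsIndepSet (↑(I₁.disjSum I₂) : Set (PWVert M v κ₂)) ∧ pwPhase W (I₁.disjSum I₂) = Y) ↔
      ((∀ g : Dart M 3 × ZMod 2, W.G.IsIndepSet (↑(univ.filter fun x => (g.1, g.2, x) ∈ I₁) : Set (Fin v))) ∧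
        (∀ δ : Dart M 3, Canon R δ → ∀ j : Fin κ₁,
          ¬ ((δ, (0 : ZMod 2), W.Vp (W.slot (Sum.inl j))) ∈ I₁ ∧ (δ, (1 : ZMod 2), W.Vp (W.slot (Sum.inl j))) ∈ I₁) ∧
            ¬ ((δ, (0 : ZMod 2), W.Vm (W.slot (Sum.inl j))) ∈ I₁ ∧ (δ, (1 : ZMod 2), W.Vm (W.slot (Sum.inl j))) ∈ I₁)) ∧
        (∀ e : Fin M × Fin 3 × ZMod 2 × Fin κ₂, Sum.inl e ∈ I₂ → ¬ (endPort R W e ∈ I₁)) ∧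
        (∀ (w : Fin M) (S' : Fin 2 → ZMod 2) (j : Fin κ₂), Sum.inr (w, S', j) ∈ I₂ →
          ∀ i : Fin 3, Sum.inl (w, i, bit (c w) S' i, j) ∉ I₂)) ∧
      ∀ g : Dart M 3 × ZMod 2, slyPhase W.Wp W.Wm (univ.filter fun x => (g.1, g.2, x) ∈ I₁) = Y g := by
  rw [isIndepSet_pwGraph_iff, pwPhase_disjSum, funext_iff]
  simp only [copyFib_disjSum, Finset.inl_mem_disjSum, Finset.inr_mem_disjSum]

/-- **`Z_{pwGraph c}(λ; phases Y)` grouped by the port configurations of the copies** (Sly's Lemma 2.2,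
second and third displays, for the parity wiring): `Z_{pwGraph c}(λ; 𝒴 = Y) = Σ_P pwPatFactor P ·
Π_g Z_G(λ; Y = Y_g, σ_V = P g)`. -/
theorem hardcoreZOn_pwGraph_phase_eq_sum (R : RotGraph M 3) (W : Wiring v m κ₁ κ₂) (c : Fin M → ZMod 2)
    (lam : ℝ) (Y : Dart M 3 × ZMod 2 → Bool) :
    hardcoreZOn (pwGraph R W c) lam (fun I => pwPhase W I = Y) =
      ∑ P : Dart M 3 × ZMod 2 → Finset (Fin m) × Finset (Fin m),
        pwPatFactor R W lam c P *
          ∏ g : Dart M 3 × ZMod 2, hardcoreZOn W.G lam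
            (fun S => slyPhase W.Wp W.Wm S = Y g ∧ portPattern W.Vp W.Vm S = P g) := by
  rw [hardcoreZOn_def, sum_finset_disjSum]
  simp_rw [prod_hardcoreZOn_eq_sum_fib, Finset.mul_sum]
  conv_rhs => rw [Finset.sum_comm]
  refine Fintype.sum_equiv (Equiv.finsetCongr (Equiv.prodAssoc (Dart M 3) (ZMod 2) (Fin v)).symm) _ _
    fun I₁ => ?_
  rw [Equiv.finsetCongr_apply]
  have hkey := indep_phase_disjSum_iff R W c Y I₁
  have hfib := filter_map_prodAssoc_symm (M := M) I₁
  rw [Finset.sum_eq_single (fun g => portPattern W.Vp W.Vm (univ.filter fun x => (g, x) ∈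
      I₁.map (Equiv.prodAssoc (Dart M 3) (ZMod 2) (Fin v)).symm.toEmbedding))]
  · -- the main term: the family of port configurations of `I₁` itself
    rw [pwPatFactor_patFam, card_map]
    have hcx := sum_cxPart_eq_prod c lam (fun e => endPort R W e ∈ I₁)
    rw [← hcx]
    split_ifs with hp hc
    · -- no pair conflict, fibres independent with the right phases: the complex parts decide
      simp only [hfib] at hc
      rw [one_mul, Finset.sum_mul]
      refine sum_congr rfl fun I₂ _ => ?_
      by_cases hb : (∀ e : Fin M × Fin 3 × ZMod 2 × Fin κ₂, Sum.inl e ∈ I₂ → ¬ (endPort R W e ∈ I₁)) ∧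
          ∀ (w : Fin M) (S' : Fin 2 → ZMod 2) (j : Fin κ₂), Sum.inr (w, S', j) ∈ I₂ →
            ∀ i : Fin 3, Sum.inl (w, i, bit (c w) S' i, j) ∉ I₂
      · rw [if_pos hb]
        split_ifs with ha
        · rw [card_disjSum, pow_add, mul_comm]
        · exact absurd ((hkey I₂).2 ⟨⟨fun g => (hc g).1, hp, hb⟩, fun g => (hc g).2.1⟩) ha
      · rw [if_neg hb, zero_mul]
        split_ifs with ha
        · exact absurd ((hkey I₂).1 ha).1.2.2 hb
        · rfl
    · -- a fibre dependent or a phase wrong: both sides vanish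
      simp only [hfib] at hc
      rw [mul_zero]
      exact Finset.sum_eq_zero fun I₂ _ => by
        split_ifs with ha
        exacts [absurd (fun g => ⟨((hkey I₂).1 ha).1.1 g, ((hkey I₂).1 ha).2 g, trivial⟩) hc, rfl]
    · -- a pair edge doubly occupied: both sides vanish
      rw [zero_mul, zero_mul]
      exact Finset.sum_eq_zero fun I₂ _ => by
        split_ifs with ha
        exacts [absurd ((hkey I₂).1 ha).1.2.1 hp, rfl]
    · rw [zero_mul, zero_mul]
      exact Finset.sum_eq_zero fun I₂ _ => by
        split_ifs with ha
        exacts [absurd ((hkey I₂).1 ha).1.2.1 hp, rfl]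
  · -- other families of port configurations do not occur
    intro P _ hP
    split_ifs with hc
    · exfalso
      exact hP (funext fun g => ((hc g).2.2).symm)
    · rw [mul_zero]
  · intro h
    exact absurd (mem_univ _) h

end Summit.PneNP.PneNP.Cruxes.PolyDepthTwinsAbove.ParityWiredPorts
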